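import Summits.HubbardSuperconductivity.HubbardSuperconductivity.Theorems.AnisotropyChordTransferFibre3RowDecomposition
import Summits.HubbardSuperconductivity.HubbardSuperconductivity.Theorems.AnisotropyChordTransferFibre3FamilyASumCscSq

/-!
# Route `AnisotropyChord` / H0 rotor rung: the torus capacity `G̃₀(0)` in EXACT ROW FORM (family A, LEMMA A0 step 1)

For the Level-2 / FIN producers of the GM₃ certificate (LEVEL2-SPEC §3 family A: the one propagator quantity `G_λ(0)` enters
`Δ(λ)`, `c_s`, `f_nn` and every row of the KT certificate; precision needed ±.01, the tree had `±.1`-class bounds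
`…CapacityUpper` / `…GresZeroSharp`).  This file is the exact 1D reduction at `λ = 0`:

* `psiRow_zero_eq`: the row profile `ψ₀ = psiRow 0` (…FamilyALemmas) equals `1/(4 sin(u/2)√(1 + sin²(u/2)))` = `1/(2 sinh μ(u))`;
* `sinh_rowMu`: `sinh μ_p = 2 sin(πp/L)√(1 + sin²(πp/L))`;  the Bose factor `b_p := 2/(e^{Lμ_p} − 1) ≥ 0` (`bose_nonneg`);
* `row_term`: `R_L(p;0) = (1 + b_p)·ψ₀(2πp/L)` (`coth(Lμ/2) = 1 + 2/(e^{Lμ} − 1)`, `cosh_div_sinh_eq`);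
* ★ `Gres_zero_rowForm`: **`V·G̃₀(0) = (L² − 1)/12 + L·Σ_{p=1}^{L−1} (1 + b_p)·ψ₀(2πp/L)`** (`L ≥ 2`), i.e.
  `Gres_zero_eq`: `G̃₀(0) = (1 − 1/L²)/12 + (1/L)Σ_{p=1}^{L−1} (1 + b_p)·ψ₀(2πp/L)` — the `m = 0` row is `Σcsc² = (L²−1)/3`
  (`sumCscSq_holds`), the other rows are `RateLemma.ring_sum_nat` at height `0`;
* `rowMu_eq_two_arsinh`: `μ_p = 2 arsinh(sin(πp/L))`, whence the lower bounds `Lμ_p ≥ 2L(s − s³/6)` used for the Bose factors.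
Step 2 (the Euler–Maclaurin evaluation of `(1/L)Σψ₀` with `PsiConvex`/`TrapezoidConvex`/`PsiZeroPrimitive` and the capacity
constant `c₀ = γ/2π + 1/12 + (½ln 2 − ln π)/2π + Σ_m 1/(πm(e^{2πm} − 1)) = 0.0487656…`) is a separate file.
Prover seat `hubbard-h0-rotor-p1` g26; helper for stmt-HubbardSuperconductivity-19089 (`--supports`, helper class).
WHAT THIS IS NOT: nothing here proves superconductivity in the Hubbard model; it is an input lemma of ONE conditional reduction (rung 19089).
Tree imports only; no new definitions; no sorry, no axioms.
-/

set_option linter.dupNamespace false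
set_option autoImplicit false

noncomputable section

open scoped BigOperators
open Real Finset

namespace Summit.HubbardSuperconductivity.HubbardSuperconductivity.Theorems.AnisotropyChord.Transfer.Fibre3

namespace CapacityConst

variable (L : ℕ) [NeZero L]

/-! ## Objects -/

/-- the row profile `ψ₀ = psiRow 0` of `…FamilyALemmas` in product form: `ψ₀(u) = 1/(4 sin(u/2) √(1 + sin²(u/2)))`
whenever `sin(u/2) ≥ 0` (`= 1/(2 sinh μ(u))`, `cosh μ(u) = 2 − cos u`). [folklore] -/
theorem psiRow_zero_eq (u : ℝ) (hu : 0 ≤ Real.sin (u / 2)) :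
    psiRow 0 u = 1 / (4 * Real.sin (u / 2) * Real.sqrt (1 + Real.sin (u / 2) ^ 2)) := by
  unfold psiRow
  rw [sub_zero, sub_zero, Real.sqrt_mul (by positivity), Real.sqrt_sq hu]
  ring

/-! ## The row rapidity through `sin(πp/L)` -/

omit [NeZero L] in
/-- `2 − cos(2πp/L) = 1 + 2 sin²(πp/L)`. [folklore] -/
theorem two_sub_cos_eq (p : ℕ) :
    2 - Real.cos (2 * Real.pi * p / L) = 1 + 2 * Real.sin (Real.pi * p / L) ^ 2 := by
  have h := Real.cos_two_mul_eq_one_sub (Real.pi * p / L)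
  rw [show 2 * (Real.pi * p / L) = 2 * Real.pi * p / L by ring] at h
  linarith

omit [NeZero L] in
/-- `sin(πp/L) ≥ 0` for `p ≤ L`. [folklore] -/
theorem sin_row_nonneg (p : ℕ) (hpL : p ≤ L) : 0 ≤ Real.sin (Real.pi * p / L) := by
  rcases Nat.eq_zero_or_pos L with hL | hL
  · subst hL; simp
  have hLr : (0 : ℝ) < L := by exact_mod_cast hL
  apply Real.sin_nonneg_of_nonneg_of_le_pi
  · positivity
  · rw [div_le_iff₀ hLr]
    have : (p : ℝ) ≤ L := by exact_mod_cast hpL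
    nlinarith [Real.pi_pos]

omit [NeZero L] in
/-- `sin(πp/L) > 0` for `0 < p < L`. [folklore] -/
theorem sin_row_pos (p : ℕ) (hp : 0 < p) (hpL : p < L) : 0 < Real.sin (Real.pi * p / L) := by
  have hLr : (0 : ℝ) < L := by exact_mod_cast (show 0 < L by omega)
  apply Real.sin_pos_of_pos_of_lt_pi
  · have : (0 : ℝ) < p := by exact_mod_cast hp
    positivity
  · rw [div_lt_iff₀ hLr]
    have : (p : ℝ) < L := by exact_mod_cast hpL
    nlinarith [Real.pi_pos]

omit [NeZero L] in
/-- ★ `sinh μ_p = 2 sin(πp/L) √(1 + sin²(πp/L))` for `p ≤ L`. [folklore] -/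
theorem sinh_rowMu (p : ℕ) (hpL : p ≤ L) :
    Real.sinh (RateLemma.rowMu L p)
      = 2 * Real.sin (Real.pi * p / L) * Real.sqrt (1 + Real.sin (Real.pi * p / L) ^ 2) := by
  rw [RateLemma.rowMu_eq_arcosh, Real.sinh_arcosh (by linarith [Real.cos_le_one (2 * Real.pi * p / L)]),
    two_sub_cos_eq]
  set s := Real.sin (Real.pi * p / L) with hs
  have hs0 : 0 ≤ s := sin_row_nonneg L p hpL
  have h1 : (1 + 2 * s ^ 2) ^ 2 - 1 = (2 * s) ^ 2 * (1 + s ^ 2) := by ring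
  rw [h1, Real.sqrt_mul (by positivity), Real.sqrt_sq (by positivity)]

omit [NeZero L] in
/-- ★ `μ_p = 2 arsinh(sin(πp/L))` for `p ≤ L`. [folklore] -/
theorem rowMu_eq_two_arsinh (p : ℕ) (hpL : p ≤ L) :
    RateLemma.rowMu L p = 2 * Real.arsinh (Real.sin (Real.pi * p / L)) := by
  set s := Real.sin (Real.pi * p / L) with hs
  have hs0 : 0 ≤ s := sin_row_nonneg L p hpL
  have hc : Real.cosh (2 * Real.arsinh s) = 2 - Real.cos (2 * Real.pi * p / L) := by
    rw [Real.cosh_two_mul, Real.cosh_arsinh, Real.sinh_arsinh, Real.sq_sqrt (by positivity), two_sub_cos_eq]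
    ring
  rw [RateLemma.rowMu_eq_arcosh, ← hc, Real.arcosh_cosh]
  have := Real.arsinh_nonneg_iff.mpr hs0
  linarith

omit [NeZero L] in
/-- the Bose factor `b_p = 2/(e^{Lμ_p} − 1) ≥ 0` for `0 < p < L`. [folklore] -/
theorem bose_nonneg (p : ℕ) (hp : 0 < p) (hpL : p < L) : 0 ≤ 2 / (Real.exp (L * RateLemma.rowMu L p) - 1) := by
  have hμ := RateLemma.rowMu_pos L p hp hpL
  have hLr : (0 : ℝ) < L := by exact_mod_cast (show 0 < L by omega)
  have : 1 < Real.exp (L * RateLemma.rowMu L p) := by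
    rw [← Real.exp_zero]
    exact Real.exp_lt_exp.mpr (by positivity)
  apply div_nonneg (by norm_num)
  linarith

/-! ## One row in closed form -/

/-- `coth y = 1 + 2/(e^{2y} − 1)` for `y > 0`, in the form `cosh y / sinh y`. [folklore] -/
theorem cosh_div_sinh_eq (y : ℝ) (hy : 0 < y) :
    Real.cosh y / Real.sinh y = 1 + 2 / (Real.exp (2 * y) - 1) := by
  have hpos : 0 < Real.exp y := Real.exp_pos y
  have hgt : 1 < Real.exp y := by
    rw [← Real.exp_zero]; exact Real.exp_lt_exp.mpr hy
  have h1 : Real.exp (2 * y) = Real.exp y * Real.exp y := by rw [two_mul, Real.exp_add]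
  have hneg : Real.exp (-y) = (Real.exp y)⁻¹ := Real.exp_neg y
  have hc : Real.cosh y = (Real.exp y * Real.exp y + 1) / (2 * Real.exp y) := by
    rw [Real.cosh_eq, hneg]; field_simp
  have hs : Real.sinh y = (Real.exp y * Real.exp y - 1) / (2 * Real.exp y) := by
    rw [Real.sinh_eq, hneg]; field_simp
  have hne2 : Real.exp y * Real.exp y - 1 ≠ 0 := by nlinarith
  have hne3 : -1 + Real.exp y ^ 2 ≠ 0 := by nlinarith
  have hne4 : Real.exp y ^ 2 - 1 ≠ 0 := by nlinarith
  rw [hc, hs, h1, div_div_div_cancel_right₀ (by positivity), div_eq_iff hne2, add_mul, one_mul,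
    show Real.exp y * Real.exp y = Real.exp y ^ 2 by ring, div_mul_cancel₀ _ hne4]
  ring

omit [NeZero L] in
/-- ★ the row resolvent at height `0`: `R_L(p;0) = (1 + b_p) · ψ₀(2πp/L)` for `0 < p < L`. [folklore] -/
theorem row_term (p : ℕ) (hp : 0 < p) (hpL : p < L) :
    RateLemma.ringR L p 0
      = (1 + 2 / (Real.exp (L * RateLemma.rowMu L p) - 1)) * psiRow 0 (2 * Real.pi * p / L) := by
  have hμ := RateLemma.rowMu_pos L p hp hpL
  have hLr : (0 : ℝ) < L := by exact_mod_cast (show 0 < L by omega)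
  have hs := sin_row_pos L p hp hpL
  set μ := RateLemma.rowMu L p with hμdef
  set s := Real.sin (Real.pi * p / L) with hsdef
  have hsinh : Real.sinh μ = 2 * s * Real.sqrt (1 + s ^ 2) := sinh_rowMu L p hpL.le
  have hy : 0 < (L : ℝ) * μ / 2 := by positivity
  have hsinhL : 0 < Real.sinh ((L : ℝ) * μ / 2) := Real.sinh_pos_iff.mpr hy
  have hcoth := cosh_div_sinh_eq ((L : ℝ) * μ / 2) hy
  rw [show 2 * ((L : ℝ) * μ / 2) = L * μ by ring, div_eq_iff hsinhL.ne'] at hcoth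
  have hsq : 0 < Real.sqrt (1 + s ^ 2) := Real.sqrt_pos.mpr (by positivity)
  have hψ := psiRow_zero_eq (2 * Real.pi * p / L)
    (by rw [show 2 * Real.pi * (p : ℝ) / L / 2 = Real.pi * p / L by ring]; exact hs.le)
  rw [show 2 * Real.pi * (p : ℝ) / L / 2 = Real.pi * p / L by ring, ← hsdef] at hψ
  rw [hψ]
  unfold RateLemma.ringR
  rw [← hμdef, show ((L : ℝ) / 2 - 0) * μ = L * μ / 2 by ring, hsinh, hcoth]
  field_simp
  ring

/-! ## ★ The capacity in row form -/

/-- ★ EXACT ROW FORM of the torus capacity at `λ = 0`: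
`V·G̃₀(0) = (L² − 1)/12 + L·Σ_{p=1}^{L−1} R_L(p;0)` (row `0` = `Σcsc²/4`, rows `p ≠ 0` = ring resolvent sums). [folklore] -/
theorem Gres_zero_rowSum (hL : 2 ≤ L) :
    (L : ℝ) ^ 2 * Gres L 0 0
      = ((L : ℝ) ^ 2 - 1) / 12 + L * ∑ p ∈ (Finset.range L).erase 0, RateLemma.ringR L p 0 := by
  have hL0 : L ≠ 0 := by omega
  have hLr : (L : ℝ) ≠ 0 := by exact_mod_cast hL0
  -- Step 1: `V·G̃₀(0)` as a double sum of real terms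
  set F : ℕ → ℕ → ℝ := fun p q =>
    if p = 0 ∧ q = 0 then 0 else
      1 / (2 * (2 - Real.cos (2 * Real.pi * p / L) - Real.cos (2 * Real.pi * q / L))) with hF
  have hk : ∀ k : Tor L, gres L 0 k * (phase L k 0).re = F k.1.val k.2.val := by
    intro k
    rw [RateLemma.phase_re]
    simp only [hF, gres, epsT]
    by_cases h0 : k = 0
    · subst h0; simp
    · have hne : ¬ (k.1.val = 0 ∧ k.2.val = 0) := by
        intro h
        apply h0
        ext <;> simp [ZMod.val_eq_zero] at h ⊢ <;> tauto
      rw [if_neg h0, if_neg hne]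
      have e1 : Real.cos (2 * Real.pi * ((k.1.val * ((0 : Tor L)).1.val + k.2.val * ((0 : Tor L)).2.val : ℕ) : ℝ) / L)
          = 1 := by simp
      rw [e1, sub_zero, mul_one]
  have hG : (L : ℝ) ^ 2 * Gres L 0 0 = ∑ k : Tor L, F k.1.val k.2.val := by
    unfold Gres
    rw [mul_div_cancel₀ _ (by positivity)]
    exact Finset.sum_congr rfl (fun k _ => hk k)
  rw [hG, Fintype.sum_prod_type]
  simp only []
  rw [show (∑ p : ZMod L, ∑ q : ZMod L, F p.val q.val) = ∑ p ∈ Finset.range L, ∑ q ∈ Finset.range L, F p q by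
    rw [RateLemma.sum_zmod_val L (fun p => ∑ q ∈ Finset.range L, F p q) |>.symm]
    refine Finset.sum_congr rfl (fun p _ => ?_)
    exact RateLemma.sum_zmod_val L (fun q => F p.val q)]
  -- Step 2: split off the row `p = 0`
  have h0 : (0 : ℕ) ∈ Finset.range L := by simp; omega
  rw [← Finset.sum_erase_add _ _ h0]
  -- the zero row = `Σ_{q=1}^{L−1} 1/(4 sin²(πq/L)) = (L²−1)/12`
  have hrow0 : (∑ q ∈ Finset.range L, F 0 q) = ((L : ℝ) ^ 2 - 1) / 12 := by
    rw [← Finset.sum_erase_add _ _ h0]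
    have : F 0 0 = 0 := by simp [hF]
    rw [this, add_zero]
    have hcsc := sumCscSq_holds L (by omega)
    rw [Finset.range_eq_Ico, ← Nat.Ico_succ_left_eq_erase_Ico]
    show ∑ q ∈ Finset.Ico 1 L, F 0 q = _
    have hterm : ∀ q ∈ Finset.Ico 1 L, F 0 q = (1 / 4) * (1 / Real.sin (Real.pi * q / L) ^ 2) := by
      intro q hq
      rw [Finset.mem_Ico] at hq
      have hq0 : ¬ (0 = 0 ∧ q = 0) := by omega
      simp only [hF, if_neg hq0]
      push_cast
      rw [mul_zero, zero_div, Real.cos_zero]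
      have h2 := two_sub_cos_eq L q
      have hs := sin_row_pos L q (by omega) hq.2
      rw [show (2 : ℝ) * (2 - 1 - Real.cos (2 * Real.pi * q / L)) = 4 * Real.sin (Real.pi * q / L) ^ 2 by linarith]
      field_simp
    rw [Finset.sum_congr rfl hterm, ← Finset.mul_sum, hcsc]
    ring
  -- the other rows = ring resolvent sums at height 0
  have hrows : ∀ p ∈ (Finset.range L).erase 0,
      (∑ q ∈ Finset.range L, F p q) = L * RateLemma.ringR L p 0 := by
    intro p hp
    rw [Finset.mem_erase, Finset.mem_range] at hp
    have hp0 : 0 < p := Nat.pos_of_ne_zero hp.1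
    have hμ := RateLemma.rowMu_pos L p hp0 hp.2
    have hc : Real.cosh (RateLemma.rowMu L p) = 2 - Real.cos (2 * Real.pi * p / L) := RateLemma.cosh_rowMu L p
    have hring := RateLemma.ring_sum_nat L (RateLemma.rowMu L p) hμ 0 (by omega)
    have hterm : ∀ q ∈ Finset.range L, F p q
        = (1 / 2) * (Real.cos (2 * Real.pi * q * (0 : ℕ) / L)
            / (Real.cosh (RateLemma.rowMu L p) - Real.cos (2 * Real.pi * q / L))) := by
      intro q _
      have : ¬ (p = 0 ∧ q = 0) := by omega
      simp only [hF, if_neg this, hc]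
      push_cast
      rw [mul_zero, zero_div, Real.cos_zero]
      have hden : 2 - Real.cos (2 * Real.pi * p / L) - Real.cos (2 * Real.pi * q / L) ≠ 0 := by
        have h1 := two_sub_cos_eq L p
        have hsp := sin_row_pos L p hp0 hp.2
        have hcq := Real.cos_le_one (2 * Real.pi * q / L)
        nlinarith
      field_simp
    rw [Finset.sum_congr rfl hterm, ← Finset.mul_sum, hring]
    unfold RateLemma.ringR
    have hsμ : Real.sinh (RateLemma.rowMu L p) ≠ 0 := (Real.sinh_pos_iff.mpr hμ).ne'
    have hLμ : Real.sinh ((L : ℝ) * RateLemma.rowMu L p / 2) ≠ 0 := by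
      have hLr' : (0 : ℝ) < L := by exact_mod_cast (show 0 < L by omega)
      exact (Real.sinh_pos_iff.mpr (by positivity)).ne'
    push_cast
    rw [sub_zero]
    field_simp
  rw [hrow0, Finset.sum_congr rfl hrows, ← Finset.mul_sum]
  ring

/-- ★ the same with the Bose factors made explicit:
`V·G̃₀(0) = (L² − 1)/12 + L·Σ_{p=1}^{L−1} (1 + b_p)·ψ₀(2πp/L)`. [folklore] -/
theorem Gres_zero_rowForm (hL : 2 ≤ L) :
    (L : ℝ) ^ 2 * Gres L 0 0
      = ((L : ℝ) ^ 2 - 1) / 12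
        + L * ∑ p ∈ (Finset.range L).erase 0,
            (1 + 2 / (Real.exp (L * RateLemma.rowMu L p) - 1)) * psiRow 0 (2 * Real.pi * p / L) := by
  rw [Gres_zero_rowSum L hL]
  congr 1
  congr 1
  refine Finset.sum_congr rfl (fun p hp => ?_)
  rw [Finset.mem_erase, Finset.mem_range] at hp
  exact row_term L p (Nat.pos_of_ne_zero hp.1) hp.2

/-- ★ normalised: `G̃₀(0) = (1 − 1/L²)/12 + (1/L)·Σ_{p=1}^{L−1} (1 + b_p)·ψ₀(2πp/L)`. [folklore] -/
theorem Gres_zero_eq (hL : 2 ≤ L) :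
    Gres L 0 0
      = (1 - 1 / (L : ℝ) ^ 2) / 12
        + (∑ p ∈ (Finset.range L).erase 0,
            (1 + 2 / (Real.exp (L * RateLemma.rowMu L p) - 1)) * psiRow 0 (2 * Real.pi * p / L)) / L := by
  have hLr : (L : ℝ) ≠ 0 := by exact_mod_cast (show L ≠ 0 by omega)
  have h := Gres_zero_rowForm L hL
  have hV : (0 : ℝ) < (L : ℝ) ^ 2 := by positivity
  have e : Gres L 0 0 = ((L : ℝ) ^ 2 * Gres L 0 0) / (L : ℝ) ^ 2 := by field_simp
  rw [e, h]
  field_simp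

end CapacityConst

end Summit.HubbardSuperconductivity.HubbardSuperconductivity.Theorems.AnisotropyChord.Transfer.Fibre3

end
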